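import Summits.CriticalPhenomena.PercolationContinuityZ3.Theorems.Transplant.SkelWinChainTA
import Summits.CriticalPhenomena.PercolationContinuityZ3.Theorems.Transplant.SkelKitResidues
import Summits.CriticalPhenomena.PercolationContinuityZ3.Theorems.Transplant.KNLevelsChainTransfer
import HarnessLib

/-!
# L6.0e — the STRAIGHT-RUN window chain (`Skel.WinAdvData`, SkelWinChainTA) PACKAGED over a `PlanarSkeletonConc`: (i) the ELONGATED inner routes
# of the face step's kit clause transferred to a dominating event (`WinAdvData.lt_real_of_advChain`), and (ii) the ROOT PROBE residue (D8) in
# straight-run form, `Skel.RootOblA`, repackaged into `Skel.RootOblT` (SkelKitResidues) with no further hypothesis — generic twin of p2's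
# `KNCells2AdvPackaging`

builds on p205010 (kernel theorem, internal audit signed; external expert review pending) — nothing in this file uses p205010.
Status sentence (coordinator 2026-08-20T04:30Z): "θ(p_c) = 0 on ℤ^d, all d ≥ 2 — kernel-verified (Lean 4/Mathlib, standard axioms); internal adversarial
audit SIGNED 2026-08-20 04:29Z; external expert review pending."
Lane `prim-bschramm-*`, seat `prim-bschramm-stmt` (gen 7; port handed over by p2-g3 19:13:45Z); helper file (`--supports stmt-CriticalPhenomena-4575`).
The two generic transfers `KNLevels.lt_real_of_chain` and `KSchA.hQ0_of_chain_sub` take an abstract linked chain `s : Fin (n+1) → TStep G'`; the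
instance's chains are straight runs `P : WinAdvData V` in the window graph `winGraph G P.root P.Rπ` (`s k := P.stepA Φ k`, true targets `P.coreT Φ k`,
enlarged targets `P.coreE Φ k = P.coreT Φ k ∪ P.Rim k`).  This file does the `Fin`-bookkeeping once.  Differences from the product, forced by
`π ↦ Rπ`: the nonemptiness of the true targets is a hypothesis (`∀ k ≤ nA, (P.coreT Φ k).Nonempty`; from (ι) `step` at the consumer), and the
first-hop set `B₀` is any subset of `X^{(0)}_0` as before (e.g. the start-box window, `WinAdvData.startBox_subset_X_zero`).
* **`WinAdvData.lt_real_of_advChain`** — per-step window facts for `k ≤ nA` under ANY weighting `W'`, a chain property of length `nA + 1` at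
  `(δ ↦ ε'')`, a source bound `1 - δ < P_{W'}(root ↔ B₀)`, the last face `coreT nA ⊆ Ft` and `P_{W'}(⋃ t ∈ Ft, root ↔ t) ≤ μA` give `1 - ε'' < μA`;
* **`Skel.RootOblA Φ S Δ' δr`** — for every direction a straight run under the root law cut to a sub-world `U' ⊆ Q_0 ∪ E_{0,du}` with the per-step
  facts at accuracy `δr nA`, the monotone-wired first hop towards some `B₀ ⊆ X^{(0)}_0`, and the far face inside `M_{a₀}(0 + du)`;
  **`rootOblT_of_rootOblA`** (pure repackaging) and **`rootObl_of_rootOblA`** (with the chain property of every length, for every window graph).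
[cite: KozmaNitzan2024, §4 p. 27 (G₀), p. 28 ((32) at the root), Lemma 11 (pp. 22–23), Lemma 12 (pp. 23–25), p. 20 / p. 30 (Step IV)]
-/

noncomputable section

open MeasureTheory ProbabilityTheory
open scoped ENNReal Classical

namespace Summit.CriticalPhenomena.PercolationContinuityZ3.Theorems

namespace Transplant

namespace Skel

/-! ## §1 The straight-run chain transferred to a dominating event (the elongated inner routes) -/

namespace WinAdvData

open Literature.Probability.Percolation Literature.Probability.LatticeModels SimpleGraph KNLevels

variable {V : Type} [DecidableEq V] {G : SimpleGraph V} [G.LocallyFinite] (Φ : PlanarSkeletonConc G)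

/-- **THE ELONGATED ROUTES OF A STRAIGHT RUN, TRANSFERRED** (generic design (D), Step IV's `h3` from a wired point source): the straight-run chain
`P` in the window graph `winGraph G P.root P.Rπ` under a weighting `W'`, with per-step subbox / support / count / kit-clause facts for `k ≤ nA`,
nonempty true targets, rim excess `≤ η ≤ δ/2`, a chain property of length `nA + 1` at `(δ ↦ ε'')`, a source bound towards some `B₀ ⊆ X^{(0)}_0`,
the far face inside `Ft` and `P_{W'}(⋃ t ∈ Ft, root ↔ t) ≤ μA` give `1 - ε'' < μA`. [cite: KozmaNitzan2024, §4 Lemma 11 (pp. 22–23), Lemma 12, p. 20 (Step IV)] -/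
theorem lt_real_of_advChain (P : WinAdvData V) (hsg : P.sg = 1 ∨ P.sg = -1)
    (hOK : ChainPlanar.Adv.AdvOK P.q P.q' P.s₁ P.ρ P.R' P.ℓ₀ P.nA) (hRl : P.Rlev + 1 ≤ P.R') (hRim : ∀ k, P.Rim k ⊆ P.stepD Φ k)
    (hTne : ∀ k ≤ P.nA, (P.coreT Φ k).Nonempty) {p : unitInterval} {W' : Sym2 V → unitInterval} {Ft B₀ : Finset V} {μA : ℝ}
    {Δ' : ℕ} {δ ε'' η : ℝ}
    (hchain : ∀ (Wg : Sym2 V → unitInterval) (s : Fin (P.nA + 1) → TStep (winGraph G P.root P.Rπ))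
      (T' : Fin (P.nA + 1) → Finset V) (η : ℝ),
      (∀ i, (s i).L.o = (s 0).L.o) →
      (∀ i : Fin P.nA, T' (Fin.castSucc i) ⊆ (s i.succ).L.X 0) →
      (∀ i, T' i ⊆ (s i).T) →
      (∀ i, (s i).KitsAt Wg p Δ' δ) →
      η ≤ δ / 2 →
      (∀ i, (prodBernoulli Wg).real (⋃ t ∈ (s i).T \ T' i, openConn (s 0).L.o t) ≤ η) →
      1 - δ < (prodBernoulli Wg).real (s 0).L.reachB →
        1 - ε'' < (prodBernoulli Wg).real (⋃ t ∈ T' (Fin.last P.nA), openConn (s 0).L.o t))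
    (hsub : ∀ k ≤ P.nA, IsSubbox (winGraph G P.root P.Rπ) W' p (P.stepD Φ k)) (hfin : FinSupp W' P.Sfin)
    (hDS : ∀ k ≤ P.nA, P.stepD Φ k ⊆ P.Sfin) (ho : ∀ k ≤ P.nA, P.root ∉ P.stepD Φ k) (hoS : P.root ∈ P.Sfin) (hj : P.j₁ ≤ P.Rlev)
    (hcount : 1 / (1 - (p : ℝ)) ^ (Δ' * P.N) ≤ δ * ((Finset.Icc P.j₀ P.j₁).card : ℝ))
    (hkits : ∀ k ≤ P.nA, ∀ j ∈ Finset.Icc P.j₀ P.j₁, ∃ (σ : SData V) (Sz : Finset V),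
      SHyp (winLData Φ P.root P.Rπ (P.alo k) (P.ahi k) P.root P.Sfin) j σ ∧ σ.N ≤ P.N ∧
      (1 - (p : ℝ) ^ σ.sB) ^ σ.k ≤ δ ∧ Sz ⊆ (winLData Φ P.root P.Rπ (P.alo k) (P.ahi k) P.root P.Sfin).X j ∧ Sz ⊆ P.stepD Φ k ∧
      (∀ x ∈ σ.K, ∀ e ∈ σ.seed x, e ∉ wireSet (↑Sz : Set V)) ∧ (∀ x ∈ σ.K, σ.face x ⊆ Sz) ∧
      (∀ x ∈ σ.K, 1 - 3 * δ ≤ (prodBernoulli W').real {ω | ∃ u ∈ σ.face x,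
        1 - δ < (prodBernoulli (pinW W' (wireSet (↑Sz : Set V)) ω)).real
          (⋃ t ∈ P.coreE Φ k, openConnIn (↑(P.stepD Φ k) : Set V) u t)}))
    (hη : η ≤ δ / 2) (hexc : ∀ k ≤ P.nA, (prodBernoulli W').real (⋃ t ∈ P.Rim k, openConn P.root t) ≤ η)
    (hB₀ : B₀ ⊆ (P.stepL Φ 0).X 0) (hsrc : 1 - δ < (prodBernoulli W').real (⋃ t ∈ B₀, openConn P.root t))
    (hTn : P.coreT Φ P.nA ⊆ Ft) (hdom : (prodBernoulli W').real (⋃ t ∈ Ft, openConn P.root t) ≤ μA) :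
    1 - ε'' < μA := by
  let s : Fin (P.nA + 1) → TStep (winGraph G P.root P.Rπ) := fun i => P.stepA Φ i
  let T' : Fin (P.nA + 1) → Finset V := fun i => P.coreT Φ i
  have hle : ∀ i : Fin (P.nA + 1), (i : ℕ) ≤ P.nA := fun i => Nat.lt_succ_iff.1 i.2
  refine lt_real_of_chain (winGraph G P.root P.Rπ) hchain s T' (fun i => P.stepA_o Φ i) (fun i => ?_) (fun i => P.coreT_subset_coreE Φ i)
    (fun i => ?_) hη (fun i => ?_) ?_ ?_ hdom
  · -- the true targets link the chain
    show P.coreT Φ (Fin.castSucc i) ⊆ (P.stepA Φ i.succ).L.X 0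
    have : ((i.succ : Fin (P.nA + 1)) : ℕ) = (Fin.castSucc i : ℕ) + 1 := by simp
    rw [show P.stepA Φ (i.succ : ℕ) = P.stepA Φ ((Fin.castSucc i : ℕ) + 1) by rw [this]]
    exact P.coreT_subset_X_zero_succ Φ hsg _
  · exact kitsAt_stepA Φ hsg hOK hRl hRim (hle i) (hTne i (hle i)) (hsub i (hle i)) hfin (hDS i (hle i)) (ho i (hle i)) hoS hj hcount
      (hkits i (hle i))
  · -- the excess of the enlarged target is inside the rim part
    refine le_trans (measureReal_mono ?_ (measure_ne_top _ _)) (hexc i (hle i))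
    intro ω hω
    simp only [Set.mem_iUnion, exists_prop] at hω ⊢
    obtain ⟨t, ht, hωt⟩ := hω
    exact ⟨t, P.coreE_sdiff_subset Φ i ht, hωt⟩
  · -- the source bound: `B₀ ⊆ X^{(0)}_0`
    show 1 - δ < (prodBernoulli W').real (P.stepA Φ ((0 : Fin (P.nA + 1)) : ℕ)).L.reachB
    rw [Fin.val_zero]
    refine hsrc.trans_le (measureReal_mono ?_ (measure_ne_top _ _))
    intro ω hω
    simp only [Set.mem_iUnion, exists_prop] at hω
    obtain ⟨t, ht, hωt⟩ := hω
    show ω ∈ (P.stepL Φ 0).reachB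
    exact Set.mem_biUnion (Finset.mem_coe.2 (hB₀ ht)) hωt
  · -- the far face lies in `Ft`
    show P.coreT Φ ((Fin.last P.nA : Fin (P.nA + 1)) : ℕ) ⊆ Ft
    rw [Fin.val_last]; exact hTn

end WinAdvData

/-! ## §2 The root probe residue in straight-run form -/

open Literature.Probability.Percolation Literature.Probability.LatticeModels SimpleGraph KNCells
open GadgetSystem ProbeHistory HSiteScheme Contour

variable {V : Type} [DecidableEq V] [Countable V] {G : SimpleGraph V} [G.LocallyFinite] (Φ : PlanarSkeletonConc G)
variable {A : Type*}

/-- **The root obligation in STRAIGHT-RUN form** (D8): for every direction `du` a straight-run window chain `P : WinAdvData V` rooted (and centred)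
at the scheme's root (sign `±1`, `AdvOK`, `Rlev + 1 ≤ R'`, rim parts inside the regions, nonempty true targets), a sub-world `U' ⊆ Q_0 ∪ E_{0,du}`
containing the root, under the root law cut to `U'` (`W0sub`): per step `k ≤ nA` the subbox property in the window graph, the support facts, the
source off the region, Step II's count and the per-level kit clause at accuracy `δr nA` towards the enlarged target `coreE k` inside `stepD k`, the
rim excess `≤ η ≤ δr nA / 2`; the monotone-wired first hop `1 - δr nA < P(root ↔ B₀)` towards some `B₀ ⊆ X^{(0)}_0`; and the far face `coreT nA`
inside `M_{a₀}(0 + du)`.  Straight-run twin of `Skel.RootOblT`. [cite: KozmaNitzan2024, §4 p. 27 (G₀), p. 28 ((32) at the root), Lemma 11] -/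
def RootOblA (S : KSchA V A) (Δ' : ℕ) (δr : ℕ → ℝ) : Prop :=
  ∀ du : MDir, ∃ (P : WinAdvData V) (U' B₀ : Finset V) (η : ℝ),
    (P.sg = 1 ∨ P.sg = -1) ∧ ChainPlanar.Adv.AdvOK P.q P.q' P.s₁ P.ρ P.R' P.ℓ₀ P.nA ∧ P.Rlev + 1 ≤ P.R' ∧
    (∀ k, P.Rim k ⊆ P.stepD Φ k) ∧ (∀ k ≤ P.nA, (P.coreT Φ k).Nonempty) ∧ P.root = S.Γ.root ∧ U' ⊆ S.U0root du ∧ S.Γ.root ∈ U' ∧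
    (∀ k ≤ P.nA, KNLevels.IsSubbox (winGraph G P.root P.Rπ) (S.W0sub G U') S.p (P.stepD Φ k)) ∧
    KNLevels.FinSupp (S.W0sub G U') P.Sfin ∧ (∀ k ≤ P.nA, P.stepD Φ k ⊆ P.Sfin) ∧ (∀ k ≤ P.nA, P.root ∉ P.stepD Φ k) ∧
    P.root ∈ P.Sfin ∧ P.j₁ ≤ P.Rlev ∧
    1 / (1 - (S.p : ℝ)) ^ (Δ' * P.N) ≤ δr P.nA * ((Finset.Icc P.j₀ P.j₁).card : ℝ) ∧
    (∀ k ≤ P.nA, ∀ j ∈ Finset.Icc P.j₀ P.j₁, ∃ (σ : KNLevels.SData V) (Sz : Finset V),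
      KNLevels.SHyp (winLData Φ P.root P.Rπ (P.alo k) (P.ahi k) P.root P.Sfin) j σ ∧ σ.N ≤ P.N ∧
      (1 - (S.p : ℝ) ^ σ.sB) ^ σ.k ≤ δr P.nA ∧ Sz ⊆ (winLData Φ P.root P.Rπ (P.alo k) (P.ahi k) P.root P.Sfin).X j ∧ Sz ⊆ P.stepD Φ k ∧
      (∀ x ∈ σ.K, ∀ e' ∈ σ.seed x, e' ∉ wireSet (↑Sz : Set V)) ∧ (∀ x ∈ σ.K, σ.face x ⊆ Sz) ∧
      (∀ x ∈ σ.K, 1 - 3 * δr P.nA ≤ (prodBernoulli (S.W0sub G U')).real {ω | ∃ u ∈ σ.face x,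
        1 - δr P.nA < (prodBernoulli (pinW (S.W0sub G U') (wireSet (↑Sz : Set V)) ω)).real
          (⋃ t ∈ P.coreE Φ k, openConnIn (↑(P.stepD Φ k) : Set V) u t)})) ∧
    η ≤ δr P.nA / 2 ∧
    (∀ k ≤ P.nA, (prodBernoulli (S.W0sub G U')).real (⋃ t ∈ P.Rim k, openConn S.Γ.root t) ≤ η) ∧
    B₀ ⊆ (P.stepL Φ 0).X 0 ∧
    1 - δr P.nA < (prodBernoulli (S.W0sub G U')).real (⋃ t ∈ B₀, openConn S.Γ.root t) ∧
    P.coreT Φ P.nA ⊆ S.Γ.M S.Γ.a₀ ((0 : Site 2) + stepVec du)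

variable {Φ}

omit [Countable V] in
/-- **`RootOblA ⟹ RootOblT`** (pure repackaging: the straight run as a `Fin (nA+1)`-indexed linked chain of target steps in the window graph
`winGraph G P.root P.Rπ`, true targets `coreT k` inside the enlarged `coreE k`, `kitsAt_stepA`, the rim bound, the first hop into `B₀ ⊆ X^{(0)}_0`).
[cite: KozmaNitzan2024, §4 p. 28 ((32) at the root), Lemma 11 (pp. 22–23)] -/
theorem rootOblT_of_rootOblA {S : KSchA V A} {Δ' : ℕ} {δr : ℕ → ℝ} (hA : RootOblA Φ S Δ' δr) : RootOblT G S Δ' δr := by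
  intro du
  obtain ⟨P, U', B₀, η, hsg, hOK, hRl, hRim, hTne, hroot, hU', hrU, hsub, hfin, hDS, ho, hoS, hj, hcount, hkits, hη, hexc, hB₀, hsrc, hTn⟩ :=
    hA du
  have hle : ∀ i : Fin (P.nA + 1), (i : ℕ) ≤ P.nA := fun i => Nat.lt_succ_iff.1 i.2
  refine ⟨P.nA, P.root, P.Rπ, U', fun i => P.stepA Φ i, fun i => P.coreT Φ i, η, hU', hrU, fun i => ?_, fun i => ?_,
    fun i => P.coreT_subset_coreE Φ i, fun i => ?_, hη, fun i => ?_, ?_, ?_⟩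
  · rw [WinAdvData.stepA_o, hroot]
  · -- the true targets link the chain
    show P.coreT Φ (Fin.castSucc i) ⊆ (P.stepA Φ i.succ).L.X 0
    have : ((i.succ : Fin (P.nA + 1)) : ℕ) = (Fin.castSucc i : ℕ) + 1 := by simp
    rw [show P.stepA Φ (i.succ : ℕ) = P.stepA Φ ((Fin.castSucc i : ℕ) + 1) by rw [this]]
    exact P.coreT_subset_X_zero_succ Φ hsg _
  · exact WinAdvData.kitsAt_stepA Φ hsg hOK hRl hRim (hle i) (hTne i (hle i)) (hsub i (hle i)) hfin (hDS i (hle i)) (ho i (hle i)) hoS hj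
      hcount (hkits i (hle i))
  · -- the excess of the enlarged target is inside the rim part
    refine le_trans (measureReal_mono ?_ (measure_ne_top _ _)) (hexc i (hle i))
    intro ω hω
    simp only [Set.mem_iUnion, exists_prop] at hω ⊢
    obtain ⟨t, ht, hωt⟩ := hω
    exact ⟨t, P.coreE_sdiff_subset Φ i ht, hωt⟩
  · -- the first hop: `B₀ ⊆ X^{(0)}_0`
    show 1 - δr P.nA < (prodBernoulli (S.W0sub G U')).real (P.stepA Φ ((0 : Fin (P.nA + 1)) : ℕ)).L.reachB
    rw [Fin.val_zero]
    refine hsrc.trans_le (measureReal_mono ?_ (measure_ne_top _ _))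
    intro ω hω
    simp only [Set.mem_iUnion, exists_prop] at hω
    obtain ⟨t, ht, hωt⟩ := hω
    show ω ∈ (P.stepL Φ 0).reachB
    rw [← hroot] at hωt
    exact Set.mem_biUnion (Finset.mem_coe.2 (hB₀ ht)) hωt
  · -- the far face lies in `M_{a₀}(0 + du)`
    show P.coreT Φ ((Fin.last P.nA : Fin (P.nA + 1)) : ℕ) ⊆ S.Γ.M S.Γ.a₀ ((0 : Site 2) + stepVec du)
    rw [Fin.val_last]; exact hTn

/-- **`RootOblA` + the chain property of every length at `(δr n ↦ δc)` for every window graph ⟹ the root conjunct (32) of `KitAtRun`**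
(`rootObl_of_rootOblT ∘ rootOblT_of_rootOblA`). [cite: KozmaNitzan2024, §4 p. 28 ((32) at the root), Lemma 12 (pp. 23–25)] -/
theorem rootObl_of_rootOblA {S : KSchA V A} {Δ' : ℕ} {δr : ℕ → ℝ}
    (hchain : ∀ (n : ℕ) (c : V) (Rπ : ℕ) (Wg : Sym2 V → unitInterval) (s : Fin (n + 1) → KNLevels.TStep (winGraph G c Rπ))
      (T' : Fin (n + 1) → Finset V) (η : ℝ),
      (∀ i : Fin (n + 1), (s i).L.o = (s 0).L.o) →
      (∀ i : Fin n, T' (Fin.castSucc i) ⊆ (s i.succ).L.X 0) →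
      (∀ i : Fin (n + 1), T' i ⊆ (s i).T) →
      (∀ i : Fin (n + 1), (s i).KitsAt Wg S.p Δ' (δr n)) →
      η ≤ δr n / 2 →
      (∀ i : Fin (n + 1), (prodBernoulli Wg).real (⋃ t ∈ (s i).T \ T' i, openConn (s 0).L.o t) ≤ η) →
      1 - δr n < (prodBernoulli Wg).real (s 0).L.reachB →
        1 - S.δc < (prodBernoulli Wg).real (⋃ t ∈ T' (Fin.last n), openConn (s 0).L.o t))
    (hA : RootOblA Φ S Δ' δr) :
    ∀ du : MDir, 1 - S.δc < (prodBernoulli (pinW (KNLevels.lattW G S.p) ↑(S.U₀ G) ↑(S.U₀ G))).real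
      (⋃ t ∈ (↑(S.Γ.M S.Γ.a₀ ((0 : Site 2) + stepVec du)) : Set V),
        openConnIn (↑(S.Γ.Q S.Γ.a₀ 0 ∪ S.Γ.Ewv S.Γ.a₀ 0 du) : Set V) S.Γ.root t) :=
  rootObl_of_rootOblT hchain (rootOblT_of_rootOblA hA)

end Skel

end Transplant

end Summit.CriticalPhenomena.PercolationContinuityZ3.Theorems

end
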